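import Summits.PneNP.PneNP.Theorems.SoloInformedIOShape
import Literature.Computability.Complexity.DTIMEPowSsubsetP
import HarnessLib

/-!
# The quantifier shape of `PneNP`: one language against every exponent

Soloist file (`solo-PneNP-informed`; landing prefix `SoloInformed`). A second kernel-checked
SHARPENING of the summit statement (no progress toward it is claimed).

`Classes.P = ⋃ₖ DTIME(nᵏ)`, so `L ∉ P` unfolds to `∀ k, L ∉ DTIME(nᵏ)` and the summit reads

  `PneNP ↔ ∃ L ∈ NP, ∀ k, L ∉ DTIME(nᵏ)`        (`soloInformed_pneNP_iff_exists_forall_not_mem_DTIME`)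
  `PneNP ↔ ∀ k, SAT ∉ DTIME(nᵏ)`                 (`soloInformed_pneNP_iff_sat_forall_not_mem_DTIME`).

The QUANTIFIER-SWAPPED statement `∀ k, ∃ L ∈ NP, L ∉ DTIME(nᵏ)` is an unconditional theorem of
the tree (`Literature.Computability.Complexity.exists_mem_NP_not_mem_DTIME_pow`, from the
deterministic time hierarchy), and its witnesses can even be taken inside `P`
(`soloInformed_forall_exists_swap_witnessed_in_P`): diagonalization against a fixed exponent
says nothing about `P` vs `NP`. The whole content of the summit is the quantifier order — ONE
language (equivalently `SAT`) defeating EVERY exponent `k` — and, combined with the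
infinitely-often shape (`SoloInformedIOShape`), the exact obligation is

  `PneNP ↔ ∀ k, ∀ D ∈ DTIME(nᵏ), {x | x ∈ SAT ↔ x ∉ D}` is infinite
                                                  (`soloInformed_pneNP_iff_sat_io_wrong_every_exponent`):

every `O(nᵏ)`-time machine, for every `k`, misclassifies infinitely many CNF codes.

References: J. Hartmanis, R. Stearns, Trans. AMS 117 (1965), Thm 9 / Cor 9.1 (time hierarchy);
S. Arora, B. Barak, *Computational Complexity* (2009), Def. 1.13, Thm 3.1, Thm 2.10;
S. Cook, *The P versus NP problem* (Clay, 2000), §1. Standard axioms only.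
-/

namespace Summit.PneNP.PneNP.Theorems

open Literature.Computability.Complexity

/-- `L ∉ P ↔ ∀ k, L ∉ DTIME(nᵏ)` — `Classes.P` is by definition `⋃ₖ DTIME(nᵏ)`.
[Arora–Barak 2009, Def. 1.13] -/
theorem soloInformed_not_mem_P_iff_forall_not_mem_DTIME (L : Language Bool) :
    L ∉ Classes.P ↔ ∀ k : ℕ, L ∉ DTIME (fun n => n ^ k) := by
  unfold Classes.P
  simp only [Set.mem_iUnion, not_exists]

/-- **∃∀ shape of the summit.** `PneNP ↔ ∃ L ∈ NP, ∀ k, L ∉ DTIME(nᵏ)`: one `NP` language beating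
every polynomial exponent. The swapped `∀ k, ∃ L ∈ NP, L ∉ DTIME(nᵏ)` is the unconditional tree
theorem `exists_mem_NP_not_mem_DTIME_pow`. [Cook, Clay §1; Arora–Barak 2009, Def. 1.13] -/
theorem soloInformed_pneNP_iff_exists_forall_not_mem_DTIME :
    PneNP ↔ ∃ L ∈ Nondeterministic.NP, ∀ k : ℕ, L ∉ DTIME (fun n => n ^ k) := by
  rw [soloInformed_pneNP_iff_exists_not_mem]
  constructor
  · rintro ⟨L, hL, hLP⟩
    exact ⟨L, hL, (soloInformed_not_mem_P_iff_forall_not_mem_DTIME L).1 hLP⟩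
  · rintro ⟨L, hL, h⟩
    exact ⟨L, hL, (soloInformed_not_mem_P_iff_forall_not_mem_DTIME L).2 h⟩

/-- **The summit on `SAT`, exponent by exponent.** `PneNP ↔ ∀ k, SAT ∉ DTIME(nᵏ)`
(Cook–Levin via `isNPComplete_SAT_holds`; `P = ⋃ₖ DTIME(nᵏ)`).
[Arora–Barak 2009, Thm 2.10 and Def. 1.13] -/
theorem soloInformed_pneNP_iff_sat_forall_not_mem_DTIME :
    PneNP ↔ ∀ k : ℕ, SAT ∉ DTIME (fun n => n ^ k) := by
  rw [← soloInformed_not_mem_P_iff_forall_not_mem_DTIME SAT,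
    soloInformed_pneNP_iff_sat_infinitely_often_wrong]
  constructor
  · intro h hSATP
    exact h SAT hSATP (soloInformed_disagreement_self_finite SAT)
  · intro hSATP D hD hfin
    exact hSATP (soloInformed_mem_P_of_finite_disagreement hD hfin)

/-- **The swapped (∀∃) statement is unconditional and witnessed inside `P`.** For every `k`
there is `L ∈ NP` with `L ∈ P` and `L ∉ DTIME(nᵏ)` (time hierarchy, tree theorem
`exists_mem_P_not_mem_DTIME_pow`, and `P ⊆ NP`): fixed-exponent diagonalization carries no
information about `P` versus `NP`. [Hartmanis–Stearns 1965, Cor 9.1; Arora–Barak 2009, Thm 3.1] -/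
theorem soloInformed_forall_exists_swap_witnessed_in_P (k : ℕ) :
    ∃ L ∈ Nondeterministic.NP, L ∈ Classes.P ∧ L ∉ DTIME (fun n => n ^ k) := by
  obtain ⟨L, hLP, hL⟩ := exists_mem_P_not_mem_DTIME_pow k
  exact ⟨L, P_subset_NP_holds hLP, hLP, hL⟩

/-- **The exact obligation, exponent by exponent and infinitely often.**
`PneNP ↔ ∀ k, ∀ D ∈ DTIME(nᵏ), {x | x ∈ SAT ↔ x ∉ D}` is infinite: `P ≠ NP` iff every
`O(nᵏ)`-time decidable language, for every `k`, errs on `SAT` on infinitely many inputs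
(from `soloInformed_pneNP_iff_sat_infinitely_often_wrong` and `P = ⋃ₖ DTIME(nᵏ)`).
[Arora–Barak 2009, Def. 1.13, Thm 2.10] -/
theorem soloInformed_pneNP_iff_sat_io_wrong_every_exponent :
    PneNP ↔ ∀ k : ℕ, ∀ D ∈ DTIME (fun n => n ^ k),
      ({x : List Bool | x ∈ SAT ↔ x ∉ D} : Set (List Bool)).Infinite := by
  rw [soloInformed_pneNP_iff_sat_infinitely_often_wrong]
  constructor
  · intro h k D hD
    exact h D (Set.mem_iUnion.2 ⟨k, hD⟩)
  · intro h D hD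
    obtain ⟨k, hk⟩ := Set.mem_iUnion.1 hD
    exact h k D hk

end Summit.PneNP.PneNP.Theorems
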